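import Literature.AlgebraicGeometry.Motives.MumfordTateInvariantsTensorPolarization
import Literature.AlgebraicGeometry.Motives.HodgeStructureHomDualTensor
import Literature.AlgebraicGeometry.Motives.HodgeStructureAbelianTypeDual
import HarnessLib

/-!
# Polarizable `ℚ`-Hodge structures are closed under tensor products and internal Hom

Family `hodge`, layer `Literature/AlgebraicGeometry/Motives` (lane `lit-hodgefound`, Layer B,
B2-20 / B2-39 / B66 «`HS^pol_ℚ` is a (semisimple) Tannakian subcategory of `HS_ℚ`», TREE side).
THEOREMS plus plumbing `def`s with bodies (a tensor basis of `ℂ ⊗ (V ⊗ W)`, the product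
polarization, the dual and the internal-Hom polarization); no notion is introduced, nothing
unproved is asserted (0 named facts).

Sources read verbatim. B. Moonen, *Families of Motives and the Mumford–Tate Conjecture*, Milan J.
Math. 85 (2017) [Moonen2017FamiliesMotives] (held text `paper:doi-10-1007-s00032-017-0273-x`, p. 3
L7), §2.1: "If `H` is a pure `ℚ`-Hodge structure of weight `n`, a polarization of `H` is a morphism
of Hodge structures `φ : H ⊗ H → ℚ(−n)` that satisfies a certain positivity property. We refer to
[31], Définition 2.1.15 or [66], Section 2.1.2 for the precise definition. […] The subcategory
`HS^pol_ℚ` is closed under direct sums, tensor products and duality, and every subquotient of a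
polarizable Hodge structure is itself again polarizable." P. Deligne, *Théorie de Hodge II*
[DeligneHodgeII1971] (cite-only), 1.1.12 (the filtration of a tensor product), 2.1.15
(polarizations). C. Voisin, *Hodge Theory and Complex Algebraic Geometry I* [VoisinHodgeI2002],
§7.1.2 (the two Hodge–Riemann bilinear relations; the hermitian form `i^{p-q} Q(x, conj y)` is
definite on `V^{p,q}` and the Hodge decomposition is orthogonal for it).

In the tree a polarization is recorded by its bilinear form and the two Hodge–Riemann relations
(`HodgeStructure.Polarization`, after Voisin I §7.1.2), and Moonen's sentence is covered clause by
clause: direct sums `IsPolarizable.pi`, duality `IsPolarizable.dual`, sub- and quotient structures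
`Polarization.restrict` / `Polarization.comap` / `IsPolarizable.quotient`, tensor powers and the
tensor spaces `T^{a,b} H` of ONE structure `IsPolarizable.tensorPower` / `IsPolarizable.tensorSpace`.
This file proves the remaining clause, the TENSOR PRODUCT OF TWO polarizable structures of
arbitrary weights `n`, `m` (no reduction to the one-structure case is possible when `n + m` is
odd), and deduces the internal Hom.

## What is proved

For `H₁ : HodgeStructure V n`, `H₂ : HodgeStructure W m` on finite-dimensional `ℚ`-spaces `V`, `W`
(one universe, `[HodgeTensorFacts.{u, u}]` for `HodgeStructure.tensor`), polarizations `Q₁`, `Q₂`: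

* `tensorBasisBC e e'` — the tensor basis `E (σ, τ) = ι⁻¹ (e σ ⊗ e' τ)` of `ℂ ⊗ (V ⊗ W)` built
  from bases `e`, `e'` of `V_ℂ`, `W_ℂ` (`ι = tensorBaseChange V W`); for GRADED bases
  (`F^a H₁ = span {e σ | a ≤ deg σ}`, `conj F^a H₁ = span {e σ | deg σ ≤ n - a}`, same for `H₂`):
  `tensor_F_eq_span` — `Fᵖ(H₁ ⊗ H₂) = span {E (σ, τ) | p ≤ deg σ + deg' τ}` (Hodge II 1.1.12 in
  coordinates), `complexConj_tensor_F_eq_span`, `tensor_piece_eq_span` —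
  `(H₁ ⊗ H₂)^{P, n+m-P} = span {E (σ, τ) | deg σ + deg' τ = P}`.
* `Polarization.tensorForm₂C_basis_basis` / `Polarization.tensorForm₂C_basis_conj_basis` — the
  product form `Q₁ ⊗ Q₂` complexified, on the tensor basis of two `h`-orthonormal graded bases
  (`Polarization.exists_orthonormal_graded_basis`): `0` unless the total degrees add up to
  `n + m`, resp. `δ · (i^{deg σ}/i^{n-deg σ})⁻¹ (i^{deg' τ}/i^{m-deg' τ})⁻¹` — the two Hodge–Riemann
  relations in coordinates; `hodgeSign_add` — `i^P/i^{n+m-P}` factorises.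
* `Polarization.tensorForm₂_flip` (`Q₁ ⊗ Q₂` is `(-1)^{n+m}`-symmetric),
  `Polarization.tensorForm₂_apply_eq_zero` (`(Q₁ ⊗ Q₂)_ℂ(Fᵖ, F^{n+m+1-p}) = 0`),
  `Polarization.tensorForm₂_pos` (`i^{P-Q'} (Q₁ ⊗ Q₂)_ℂ(x, conj x) = Σ |c_k|² > 0` for
  `0 ≠ x ∈ (H₁ ⊗ H₂)^{P,Q'}`).
* **`Polarization.tensor Q₁ Q₂ : Polarization (H₁.tensor H₂)`** — the product polarization, form
  Mathlib's `LinearMap.BilinForm.tmul Q₁.form Q₂.form`, `(v ⊗ w, v' ⊗ w') ↦ Q₁(v, v') Q₂(w, w')`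
  (`Polarization.tensor_form_tmul`); **`IsPolarizable.tensor`** — `H₁`, `H₂` polarizable ⇒
  `H₁ ⊗ H₂` polarizable.
* `Polarization.dual Q : Polarization H.dual` (the explicit term behind the tree's
  `IsPolarizable.dual`; its form is the inverse form `Polarization.dualForm`, `Polarization.dual_form`),
  **`Polarization.hom Q₁ Q₂ : Polarization (H₁.hom H₂)`** (pulled back from `H₁^∨ ⊗ H₂` along the
  tree's isomorphism `Hom.homToDualTensor`, El Zein–Lê §3.1.1.3) and **`IsPolarizable.hom`**.
-/

noncomputable section

open scoped TensorProduct
open Complex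

namespace Literature.AlgebraicGeometry.Motives

namespace HodgeStructure

universe u

variable {V : Type u} [AddCommGroup V] [Module ℚ V] {W : Type u} [AddCommGroup W] [Module ℚ W]
  {n m : ℤ}

/-! ### The product form `Q₁ ⊗ Q₂` on pure tensors -/

/-- `ι⁻¹ ((a ⊗ v) ⊗ (b ⊗ w)) = (a b) ⊗ (v ⊗ w)` for `ι = tensorBaseChange V W`. Private plumbing.
[folklore] -/
private theorem tensorBaseChange_symm_tmul_tmul (a b : ℂ) (v : V) (w : W) :
    (tensorBaseChange V W).symm ((a ⊗ₜ[ℚ] v) ⊗ₜ[ℂ] (b ⊗ₜ[ℚ] w)) = (a * b) ⊗ₜ[ℚ] (v ⊗ₜ[ℚ] w) :=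
  TensorProduct.AlgebraTensorModule.distribBaseChange_symm_tmul (R := ℚ) (A := ℂ) v w a b

/-- `(B₁ ⊗ B₂)(v ⊗ w, v' ⊗ w') = B₁(v, v') B₂(w, w')` (Mathlib's `LinearMap.BilinForm.tmul`).
Private plumbing. [folklore] -/
private theorem bilinForm_tmul_apply (B₁ : LinearMap.BilinForm ℚ V) (B₂ : LinearMap.BilinForm ℚ W)
    (v v' : V) (w w' : W) :
    (B₁.tmul B₂ : LinearMap.BilinForm ℚ (V ⊗[ℚ] W)) (v ⊗ₜ[ℚ] w) (v' ⊗ₜ[ℚ] w') =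
      B₁ v v' * B₂ w w' := by
  rw [LinearMap.BilinForm.tmul, LinearMap.BilinForm.tensorDistrib_tmul, smul_eq_mul, mul_comm]

/-- Two bilinear forms on `V ⊗ W` agreeing on pure tensors are equal. Private plumbing.
[folklore] -/
private theorem bilinForm_ext_tmul {B B' : LinearMap.BilinForm ℚ (V ⊗[ℚ] W)}
    (h : ∀ (v : V) (w : W) (v' : V) (w' : W),
      B (v ⊗ₜ[ℚ] w) (v' ⊗ₜ[ℚ] w') = B' (v ⊗ₜ[ℚ] w) (v' ⊗ₜ[ℚ] w')) : B = B' :=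
  TensorProduct.ext' fun v w => TensorProduct.ext' fun v' w' => h v w v' w'

/-- **The complexified product form on pure tensors**:
`(B₁ ⊗ B₂)_ℂ(ι⁻¹ (x ⊗ y), ι⁻¹ (x' ⊗ y')) = B₁,ℂ(x, x') · B₂,ℂ(y, y')` for `x, x' ∈ V_ℂ`,
`y, y' ∈ W_ℂ`. Private plumbing. [folklore] -/
private theorem bilinForm_tmul_baseChange_apply (B₁ : LinearMap.BilinForm ℚ V)
    (B₂ : LinearMap.BilinForm ℚ W) (x x' : ℂ ⊗[ℚ] V) (y y' : ℂ ⊗[ℚ] W) :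
    LinearMap.BilinForm.baseChange ℂ (B₁.tmul B₂ : LinearMap.BilinForm ℚ (V ⊗[ℚ] W))
        ((tensorBaseChange V W).symm (x ⊗ₜ[ℂ] y)) ((tensorBaseChange V W).symm (x' ⊗ₜ[ℂ] y')) =
      B₁.baseChange ℂ x x' * B₂.baseChange ℂ y y' := by
  induction x using TensorProduct.induction_on with
  | zero => simp
  | add x₁ x₂ h₁ h₂ =>
    simp only [TensorProduct.add_tmul, map_add, LinearMap.add_apply, h₁, h₂, add_mul]
  | tmul a v =>
    induction y using TensorProduct.induction_on with
    | zero => simp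
    | add y₁ y₂ h₁ h₂ =>
      simp only [TensorProduct.tmul_add, map_add, LinearMap.add_apply, h₁, h₂, mul_add]
    | tmul b w =>
      induction x' using TensorProduct.induction_on with
      | zero => simp
      | add x₁ x₂ h₁ h₂ =>
        simp only [TensorProduct.add_tmul, map_add, h₁, h₂, add_mul]
      | tmul a' v' =>
        induction y' using TensorProduct.induction_on with
        | zero => simp
        | add y₁ y₂ h₁ h₂ =>
          simp only [TensorProduct.tmul_add, map_add, h₁, h₂, mul_add]
        | tmul b' w' =>
          rw [tensorBaseChange_symm_tmul_tmul, tensorBaseChange_symm_tmul_tmul]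
          simp only [LinearMap.BilinForm.baseChange_tmul, bilinForm_tmul_apply, Rat.smul_def]
          push_cast
          ring

/-! ### The Hodge signs multiply -/

/-- **`i^{P}/i^{n+m-P}` factorises**: `hodgeSign (n + m) (a + c) = hodgeSign n a · hodgeSign m c`
(`hodgeSign n p = i^p (i^{n-p})⁻¹ = i^{2p-n}`, the unit of the second Hodge–Riemann relation on
`V^{p,n-p}`; Voisin I §7.1.2). [cite: VoisinHodgeI2002, §7.1.2 Def. 7.7] -/
theorem hodgeSign_add (n m a c : ℤ) : hodgeSign (n + m) (a + c) = hodgeSign n a * hodgeSign m c := by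
  rw [hodgeSign_eq_zpow, hodgeSign_eq_zpow, hodgeSign_eq_zpow, ← zpow_add₀ I_ne_zero]
  congr 1
  ring

/-- The sign bookkeeping of the second Hodge–Riemann relation on `(H₁ ⊗ H₂)^{a+c, ·}`:
`hodgeSign (n+m) (a+c) · ((hodgeSign n a)⁻¹ (hodgeSign m c)⁻¹) = 1`.
[cite: VoisinHodgeI2002, §7.1.2 Def. 7.7] -/
theorem hodgeSign_add_mul_inv_mul_inv (n m a c : ℤ) :
    hodgeSign (n + m) (a + c) * ((hodgeSign n a)⁻¹ * (hodgeSign m c)⁻¹) = 1 := by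
  rw [hodgeSign_add, mul_mul_mul_comm, mul_inv_cancel₀ (hodgeSign_ne_zero n a),
    mul_inv_cancel₀ (hodgeSign_ne_zero m c), one_mul]

/-! ### Graded tensor bases of `ℂ ⊗ (V ⊗ W)` -/

section Basis

variable {S T : Type u}

/-- The **tensor basis** `E (σ, τ) = ι⁻¹ (e σ ⊗ e' τ)` of `ℂ ⊗_ℚ (V ⊗_ℚ W)` built from bases `e`
of `V_ℂ` and `e'` of `W_ℂ`: Mathlib's `Basis.tensorProduct` transported along the inverse of the
comparison isomorphism `ι = tensorBaseChange V W : ℂ ⊗ (V ⊗ W) ≃ V_ℂ ⊗_ℂ W_ℂ` (the basis in which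
Deligne's `Fᵖ(V ⊗ W) = Σ_{a+b=p} Fᵃ ⊗ Fᵇ`, Hodge II 1.1.12, is read off). [cite: DeligneHodgeII1971, 1.1.12] -/
def tensorBasisBC (e : Module.Basis S ℂ (ℂ ⊗[ℚ] V)) (e' : Module.Basis T ℂ (ℂ ⊗[ℚ] W)) :
    Module.Basis (S × T) ℂ (ℂ ⊗[ℚ] (V ⊗[ℚ] W)) :=
  (e.tensorProduct e').map (tensorBaseChange V W).symm

/-- Unfolding of `tensorBasisBC`. [cite: DeligneHodgeII1971, 1.1.12] -/
theorem tensorBasisBC_def (e : Module.Basis S ℂ (ℂ ⊗[ℚ] V)) (e' : Module.Basis T ℂ (ℂ ⊗[ℚ] W)) :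
    (e.tensorProduct e').map (tensorBaseChange V W).symm = tensorBasisBC e e' :=
  rfl

/-- `E (σ, τ) = ι⁻¹ (e σ ⊗ e' τ)`. [cite: DeligneHodgeII1971, 1.1.12] -/
theorem tensorBasisBC_apply (e : Module.Basis S ℂ (ℂ ⊗[ℚ] V)) (e' : Module.Basis T ℂ (ℂ ⊗[ℚ] W))
    (x : S × T) :
    tensorBasisBC e e' x = (tensorBaseChange V W).symm (e x.1 ⊗ₜ[ℂ] e' x.2) := by
  rw [tensorBasisBC, Module.Basis.map_apply, Module.Basis.tensorProduct_apply']

/-- **Complex conjugation of the tensor basis vectors**: `conj (E (σ, τ)) = ι⁻¹ (conj (e σ) ⊗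
conj (e' τ))` (`conj ⊗ id` on `ℂ ⊗ (V ⊗ W)` is `conj ⊗ conj` through `ι`, the tree's
`conj_tensorBaseChange_symm_tmul`). [cite: DeligneHodgeII1971, 1.1.12 and 2.1.15] -/
theorem conj_tensorBasisBC (e : Module.Basis S ℂ (ℂ ⊗[ℚ] V)) (e' : Module.Basis T ℂ (ℂ ⊗[ℚ] W))
    (x : S × T) :
    conj (tensorBasisBC e e' x) =
      (tensorBaseChange V W).symm (conj (e x.1) ⊗ₜ[ℂ] conj (e' x.2)) := by
  rw [tensorBasisBC_apply, conj_tensorBaseChange_symm_tmul]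

end Basis

/-! ### The product form `Q₁ ⊗ Q₂` -/

/-- **The product form `Q₁ ⊗ Q₂` on `V ⊗ W`**: `(v ⊗ w, v' ⊗ w') ↦ Q₁(v, v') Q₂(w, w')`
(Mathlib's `LinearMap.BilinForm.tmul`, typed as a bilinear form so that `.baseChange ℂ` is the
`ℂ`-valued complexification). This is the form of the product polarization `Polarization.tensor`
("`HS^pol_ℚ` is closed under […] tensor products", Moonen §2.1; Deligne, Hodge II, 2.1.15).
[cite: Moonen2017FamiliesMotives, §2.1 (p. 3)] [cite: DeligneHodgeII1971, 2.1.15] -/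
def Polarization.tensorForm₂ {H₁ : HodgeStructure V n} {H₂ : HodgeStructure W m}
    (Q₁ : Polarization H₁) (Q₂ : Polarization H₂) : LinearMap.BilinForm ℚ (V ⊗[ℚ] W) :=
  Q₁.form.tmul Q₂.form

/-- On pure tensors: `(Q₁ ⊗ Q₂)(v ⊗ w, v' ⊗ w') = Q₁(v, v') Q₂(w, w')`.
[cite: Moonen2017FamiliesMotives, §2.1 (p. 3)] [cite: DeligneHodgeII1971, 2.1.15] -/
theorem Polarization.tensorForm₂_tmul {H₁ : HodgeStructure V n} {H₂ : HodgeStructure W m}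
    (Q₁ : Polarization H₁) (Q₂ : Polarization H₂) (v v' : V) (w w' : W) :
    Q₁.tensorForm₂ Q₂ (v ⊗ₜ[ℚ] w) (v' ⊗ₜ[ℚ] w') = Q₁.form v v' * Q₂.form w w' :=
  bilinForm_tmul_apply Q₁.form Q₂.form v v' w w'

/-- The complexified product form on pure tensors through `ι = tensorBaseChange V W`:
`(Q₁ ⊗ Q₂)_ℂ(ι⁻¹ (x ⊗ y), ι⁻¹ (x' ⊗ y')) = Q₁,ℂ(x, x') Q₂,ℂ(y, y')`.
[cite: DeligneHodgeII1971, 1.1.12 and 2.1.15] -/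
theorem Polarization.tensorForm₂C_symm_tmul {H₁ : HodgeStructure V n} {H₂ : HodgeStructure W m}
    (Q₁ : Polarization H₁) (Q₂ : Polarization H₂) (x x' : ℂ ⊗[ℚ] V) (y y' : ℂ ⊗[ℚ] W) :
    (Q₁.tensorForm₂ Q₂).baseChange ℂ ((tensorBaseChange V W).symm (x ⊗ₜ[ℂ] y))
        ((tensorBaseChange V W).symm (x' ⊗ₜ[ℂ] y')) =
      Q₁.form.baseChange ℂ x x' * Q₂.form.baseChange ℂ y y' :=
  bilinForm_tmul_baseChange_apply Q₁.form Q₂.form x x' y y'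

/-! ### The product form in an `h`-orthonormal graded tensor basis -/

section Coordinates

variable {S T : Type u} {deg : S → ℤ} {deg' : T → ℤ} {H₁ : HodgeStructure V n}
  {H₂ : HodgeStructure W m}

/-- **First Hodge–Riemann relation in coordinates.** If `e σ ∈ V^{deg σ, n - deg σ}` and
`e' τ ∈ W^{deg' τ, m - deg' τ}` for all `σ`, `τ`, then
`(Q₁ ⊗ Q₂)_ℂ(E (σ, τ), E (σ', τ')) = Q₁,ℂ(e σ, e σ') Q₂,ℂ(e' τ, e' τ') = 0` unless
`deg σ + deg' τ + deg σ' + deg' τ' = n + m` (each factor vanishes off the anti-diagonal: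
`Q_ℂ(V^{p,·}, V^{p',·}) = 0` for `p + p' ≠ n`, the tree's `Polarization.form_piece_piece`,
Voisin I §7.1.2). [cite: VoisinHodgeI2002, §7.1.2 Def. 7.7] -/
theorem Polarization.tensorForm₂C_basis_basis (Q₁ : Polarization H₁) (Q₂ : Polarization H₂)
    (e : Module.Basis S ℂ (ℂ ⊗[ℚ] V)) (e' : Module.Basis T ℂ (ℂ ⊗[ℚ] W))
    (he : ∀ σ, e σ ∈ H₁.piece (deg σ) (n - deg σ))
    (he' : ∀ τ, e' τ ∈ H₂.piece (deg' τ) (m - deg' τ)) {x y : S × T}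
    (hxy : deg x.1 + deg' x.2 + (deg y.1 + deg' y.2) ≠ n + m) :
    (Q₁.tensorForm₂ Q₂).baseChange ℂ (tensorBasisBC e e' x) (tensorBasisBC e e' y) = 0 := by
  rw [tensorBasisBC_apply, tensorBasisBC_apply, tensorForm₂C_symm_tmul]
  by_contra hne
  obtain ⟨h1, h2⟩ := mul_ne_zero_iff.1 hne
  have hk : deg x.1 + deg y.1 = n := by
    by_contra hk
    exact h1 (Q₁.form_piece_piece hk (he _) (he _))
  have hl : deg' x.2 + deg' y.2 = m := by
    by_contra hl
    exact h2 (Q₂.form_piece_piece hl (he' _) (he' _))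
  apply hxy
  omega

variable [DecidableEq S] [DecidableEq T]

/-- **Second Hodge–Riemann relation in coordinates.** For `h`-orthonormal graded bases
(`Q₁,ℂ(e σ, conj (e σ')) = δ_{σσ'} (hodgeSign n (deg σ))⁻¹`, same for `e'`):
`(Q₁ ⊗ Q₂)_ℂ(E (σ, τ), conj (E (σ', τ'))) = δ · (hodgeSign n (deg σ))⁻¹ (hodgeSign m (deg' τ))⁻¹`
— the tensor basis is again `h`-orthogonal (Voisin I §7.1.2: the Hodge decomposition is
orthogonal for `i^{p-q} Q(x, conj y)`). [cite: VoisinHodgeI2002, §7.1.2 Def. 7.7] -/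
theorem Polarization.tensorForm₂C_basis_conj_basis (Q₁ : Polarization H₁) (Q₂ : Polarization H₂)
    (e : Module.Basis S ℂ (ℂ ⊗[ℚ] V)) (e' : Module.Basis T ℂ (ℂ ⊗[ℚ] W))
    (hon : ∀ σ σ', Q₁.form.baseChange ℂ (e σ) (conj (e σ')) =
      if σ = σ' then (hodgeSign n (deg σ))⁻¹ else 0)
    (hon' : ∀ τ τ', Q₂.form.baseChange ℂ (e' τ) (conj (e' τ')) =
      if τ = τ' then (hodgeSign m (deg' τ))⁻¹ else 0)
    (x y : S × T) :
    (Q₁.tensorForm₂ Q₂).baseChange ℂ (tensorBasisBC e e' x) (conj (tensorBasisBC e e' y)) =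
      if x = y then (hodgeSign n (deg x.1))⁻¹ * (hodgeSign m (deg' x.2))⁻¹ else 0 := by
  rw [conj_tensorBasisBC, tensorBasisBC_apply, tensorForm₂C_symm_tmul, hon, hon']
  by_cases hxy : x = y
  · subst hxy
    simp
  · rw [if_neg hxy]
    have h : x.1 ≠ y.1 ∨ x.2 ≠ y.2 := by
      by_contra hall
      simp only [not_or, not_not] at hall
      exact hxy (Prod.ext hall.1 hall.2)
    rcases h with h | h
    · rw [if_neg h, zero_mul]
    · rw [if_neg h, mul_zero]

end Coordinates

/-! ### Symmetry of the product form -/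

/-- **`Q₁ ⊗ Q₂` is `(-1)^{n+m}`-symmetric**: `(Q₁ ⊗ Q₂)(y, x) = (-1)^{n+m} (Q₁ ⊗ Q₂)(x, y)`
(from `Q₁(v', v) = (-1)^n Q₁(v, v')`, `Q₂(w', w) = (-1)^m Q₂(w, w')`, Voisin I §7.1.2, checked on
pure tensors). [cite: VoisinHodgeI2002, §7.1.2] [cite: DeligneHodgeII1971, 2.1.15] -/
theorem Polarization.tensorForm₂_flip {H₁ : HodgeStructure V n} {H₂ : HodgeStructure W m}
    (Q₁ : Polarization H₁) (Q₂ : Polarization H₂) :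
    (Q₁.tensorForm₂ Q₂).flip = (((n + m).negOnePow : ℤˣ) : ℤ) • Q₁.tensorForm₂ Q₂ := by
  refine bilinForm_ext_tmul fun v w v' w' => ?_
  rw [LinearMap.BilinForm.flip_apply, LinearMap.smul_apply, LinearMap.smul_apply, tensorForm₂_tmul,
    tensorForm₂_tmul, Q₁.form_swap v v', Q₂.form_swap w w', zsmul_eq_mul, Int.negOnePow_add,
    Units.val_mul, Int.cast_mul]
  ring

variable [HodgeTensorFacts.{u, u}]

/-! ### The Hodge filtration of `H₁ ⊗ H₂` in a graded tensor basis -/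

section Filtration

variable {S T : Type u} {deg : S → ℤ} {deg' : T → ℤ}

/-- **The Hodge filtration of `H₁ ⊗ H₂` in the graded tensor basis** (Deligne, Hodge II, 1.1.12:
`Fᵖ(V ⊗ W) = Σ_{a+b ≥ p} Fᵃ V ⊗ Fᵇ W`; for graded bases `Fᵃ V = span {e σ | a ≤ deg σ}`,
`Fᵇ W = span {e' τ | b ≤ deg' τ}` this is the span of the tensor basis vectors of total degree
`≥ p`): `Fᵖ(H₁ ⊗ H₂) = span {E (σ, τ) | p ≤ deg σ + deg' τ}`. [cite: DeligneHodgeII1971, 1.1.12] -/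
theorem tensor_F_eq_span (H₁ : HodgeStructure V n) (H₂ : HodgeStructure W m)
    (e : Module.Basis S ℂ (ℂ ⊗[ℚ] V)) (e' : Module.Basis T ℂ (ℂ ⊗[ℚ] W))
    (hF : ∀ a, H₁.F a = Submodule.span ℂ (e '' {σ | a ≤ deg σ}))
    (hF' : ∀ b, H₂.F b = Submodule.span ℂ (e' '' {τ | b ≤ deg' τ})) (p : ℤ) :
    (H₁.tensor H₂).F p =
      Submodule.span ℂ (tensorBasisBC e e' '' {x | p ≤ deg x.1 + deg' x.2}) := by
  rw [tensor_F, tensorFiltration]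
  simp_rw [TensorProduct.range_mapIncl, hF, hF', map₂_mk_span_span, comap_span_basis_image,
    tensorBasisBC_def]
  exact iSup_span_image_prod_le_eq _ deg deg' p

/-- **The conjugate filtration of `H₁ ⊗ H₂` in the graded tensor basis**:
`conj F^q(H₁ ⊗ H₂) = span {E (σ, τ) | deg σ + deg' τ ≤ n + m - q}` (from
`conj Fᵃ V = span {e σ | deg σ ≤ n - a}`, `conj Fᵇ W = span {e' τ | deg' τ ≤ m - b}` and
`conj (Fᵃ ⊗ Fᵇ) = conj Fᵃ ⊗ conj Fᵇ`, the tree's `complexConj_comap_map₂_mk`; Hodge II 1.1.12 with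
1.2.5). [cite: DeligneHodgeII1971, 1.1.12 and 1.2.5] -/
theorem complexConj_tensor_F_eq_span (H₁ : HodgeStructure V n) (H₂ : HodgeStructure W m)
    (e : Module.Basis S ℂ (ℂ ⊗[ℚ] V)) (e' : Module.Basis T ℂ (ℂ ⊗[ℚ] W))
    (hFc : ∀ a, complexConj (H₁.F a) = Submodule.span ℂ (e '' {σ | deg σ ≤ n - a}))
    (hFc' : ∀ b, complexConj (H₂.F b) = Submodule.span ℂ (e' '' {τ | deg' τ ≤ m - b})) (q : ℤ) :
    complexConj ((H₁.tensor H₂).F q) =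
      Submodule.span ℂ (tensorBasisBC e e' '' {x | deg x.1 + deg' x.2 ≤ n + m - q}) := by
  rw [tensor_F]
  simp only [tensorFiltration, TensorProduct.range_mapIncl, ← complexConjOrderIso_apply,
    OrderIso.map_iSup]
  simp only [complexConjOrderIso_apply, complexConj_comap_map₂_mk]
  simp_rw [hFc, hFc', map₂_mk_span_span, comap_span_basis_image, tensorBasisBC_def]
  exact iSup_span_image_prod_ge_eq _ deg deg' n m q

/-- **The Hodge pieces of `H₁ ⊗ H₂` in the graded tensor basis**: on the line `P + Q' = n + m`,
`(H₁ ⊗ H₂)^{P,Q'} = Fᴾ ∩ conj F^{Q'} = span {E (σ, τ) | deg σ + deg' τ = P}` — the tensor basis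
vector `E (σ, τ)` has Hodge type `(deg σ + deg' τ, ·)` (Hodge II 1.1.12: the bigrading of a
tensor product is the total bigrading). [cite: DeligneHodgeII1971, 1.1.12 and 1.2.5] -/
theorem tensor_piece_eq_span (H₁ : HodgeStructure V n) (H₂ : HodgeStructure W m)
    (e : Module.Basis S ℂ (ℂ ⊗[ℚ] V)) (e' : Module.Basis T ℂ (ℂ ⊗[ℚ] W))
    (hF : ∀ a, H₁.F a = Submodule.span ℂ (e '' {σ | a ≤ deg σ}))
    (hF' : ∀ b, H₂.F b = Submodule.span ℂ (e' '' {τ | b ≤ deg' τ}))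
    (hFc : ∀ a, complexConj (H₁.F a) = Submodule.span ℂ (e '' {σ | deg σ ≤ n - a}))
    (hFc' : ∀ b, complexConj (H₂.F b) = Submodule.span ℂ (e' '' {τ | deg' τ ≤ m - b}))
    {P Q' : ℤ} (hPQ : P + Q' = n + m) :
    (H₁.tensor H₂).piece P Q' =
      Submodule.span ℂ (tensorBasisBC e e' '' {x | deg x.1 + deg' x.2 = P}) := by
  rw [piece_of_add_eq _ hPQ, tensor_F_eq_span H₁ H₂ e e' hF hF',
    complexConj_tensor_F_eq_span H₁ H₂ e e' hFc hFc', span_basis_image_inf]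
  congr 2
  ext x
  simp only [Set.mem_inter_iff, Set.mem_setOf_eq]
  omega

end Filtration

/-! ### The two Hodge–Riemann relations for `Q₁ ⊗ Q₂` -/

variable [Module.Finite ℚ V] [Module.Finite ℚ W] {H₁ : HodgeStructure V n} {H₂ : HodgeStructure W m}

/-- **First Hodge–Riemann relation for `Q₁ ⊗ Q₂`**: `(Q₁ ⊗ Q₂)_ℂ(Fᵖ(H₁ ⊗ H₂), F^{n+m+1-p}(H₁ ⊗ H₂))
= 0` — equivalently (Deligne, Hodge II, 2.1.15; Moonen §2.1) `Q₁ ⊗ Q₂ : (H₁ ⊗ H₂)^{⊗2} → ℚ(-n-m)`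
respects the Hodge filtrations. Read off in the tensor basis of two `h`-orthonormal graded bases:
basis vectors of total degrees `≥ p` and `≥ n+m+1-p` pair to `0` (`tensorForm₂C_basis_basis`).
[cite: DeligneHodgeII1971, 2.1.15] [cite: VoisinHodgeI2002, §7.1.2 Def. 7.7] -/
theorem Polarization.tensorForm₂_apply_eq_zero (Q₁ : Polarization H₁) (Q₂ : Polarization H₂)
    (p : ℤ) (x : ℂ ⊗[ℚ] (V ⊗[ℚ] W)) (hx : x ∈ (H₁.tensor H₂).F p) (y : ℂ ⊗[ℚ] (V ⊗[ℚ] W))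
    (hy : y ∈ (H₁.tensor H₂).F (n + m + 1 - p)) :
    (Q₁.tensorForm₂ Q₂).baseChange ℂ x y = 0 := by
  obtain ⟨S, _, _, deg, e, hF, -, he, -⟩ := Q₁.exists_orthonormal_graded_basis
  obtain ⟨T, _, _, deg', e', hF', -, he', -⟩ := Q₂.exists_orthonormal_graded_basis
  rw [tensor_F_eq_span H₁ H₂ e e' hF hF'] at hx hy
  refine bilinForm_eq_zero_of_mem_span _ _ _ _ (fun i hi j hj => ?_) hx hy
  simp only [Set.mem_setOf_eq] at hi hj
  exact Q₁.tensorForm₂C_basis_basis Q₂ e e' he he' (by omega)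

/-- **Second Hodge–Riemann relation for `Q₁ ⊗ Q₂`**: for `0 ≠ x ∈ (H₁ ⊗ H₂)^{P,Q'}`,
`P + Q' = n + m`, the number `i^P (i^{Q'})⁻¹ (Q₁ ⊗ Q₂)_ℂ(x, conj x)` is a positive real. In the
tensor basis `E` of two `h`-orthonormal graded bases, `x = Σ c_k E k` over `k = (σ, τ)` of total
degree `P` (`tensor_piece_eq_span`), the basis is `h`-orthogonal with
`(Q₁ ⊗ Q₂)_ℂ(E k, conj (E k)) = (hodgeSign n (deg σ))⁻¹ (hodgeSign m (deg' τ))⁻¹`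
(`tensorForm₂C_basis_conj_basis`), and the signs cancel (`hodgeSign_add_mul_inv_mul_inv`): the
quantity is `Σ |c_k|²` (Voisin I §7.1.2; Deligne, Hodge II, 2.1.15).
[cite: DeligneHodgeII1971, 2.1.15] [cite: VoisinHodgeI2002, §7.1.2 Def. 7.7] -/
theorem Polarization.tensorForm₂_pos (Q₁ : Polarization H₁) (Q₂ : Polarization H₂) (P Q' : ℤ)
    (hPQ : P + Q' = n + m) (x : ℂ ⊗[ℚ] (V ⊗[ℚ] W)) (hx : x ∈ (H₁.tensor H₂).piece P Q')
    (hx0 : x ≠ 0) :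
    ∃ r : ℝ, 0 < r ∧ Complex.I ^ P * (Complex.I ^ Q')⁻¹ *
      (Q₁.tensorForm₂ Q₂).baseChange ℂ x (conj x) = r := by
  obtain ⟨S, _, _, deg, e, hF, hFc, -, hon⟩ := Q₁.exists_orthonormal_graded_basis
  obtain ⟨T, _, _, deg', e', hF', hFc', -, hon'⟩ := Q₂.exists_orthonormal_graded_basis
  rw [tensor_piece_eq_span H₁ H₂ e e' hF hF' hFc hFc' hPQ] at hx
  obtain ⟨c, hc⟩ : ∃ c : S × T → ℂ, ∀ k, c k = (tensorBasisBC e e').repr x k := ⟨_, fun _ => rfl⟩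
  have hsupp : ∀ k, c k ≠ 0 → deg k.1 + deg' k.2 = P := by
    intro k hk
    have h := (Module.Basis.mem_span_image (tensorBasisBC e e')).1 hx
    rw [hc] at hk
    exact h (Finsupp.mem_support_iff.2 hk)
  -- expand `x` and `conj x` in the tensor basis
  have hxsum : x = ∑ k, c k • tensorBasisBC e e' k := by
    simp_rw [hc]
    exact ((tensorBasisBC e e').sum_repr x).symm
  have hconj : conj x = ∑ k, starRingEnd ℂ (c k) • conj (tensorBasisBC e e' k) := by
    conv_lhs => rw [hxsum]
    rw [map_sum]
    simp_rw [conj_smul]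
  have hval : (Q₁.tensorForm₂ Q₂).baseChange ℂ x (conj x) =
      ∑ k, c k * starRingEnd ℂ (c k) *
        ((hodgeSign n (deg k.1))⁻¹ * (hodgeSign m (deg' k.2))⁻¹) := by
    rw [hconj]
    conv_lhs => rw [hxsum]
    simp_rw [map_sum, LinearMap.sum_apply, map_smul, LinearMap.smul_apply, smul_eq_mul,
      Q₁.tensorForm₂C_basis_conj_basis Q₂ e e' hon hon', mul_ite, mul_zero]
    refine Finset.sum_congr rfl fun k _ => ?_
    rw [Finset.sum_ite_eq', if_pos (Finset.mem_univ k)]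
    ring
  have hsign : Complex.I ^ P * (Complex.I ^ Q')⁻¹ = hodgeSign (n + m) P := by
    rw [hodgeSign, show n + m - P = Q' by omega]
  refine ⟨∑ k, Complex.normSq (c k), ?_, ?_⟩
  · -- positivity: some coefficient is non-zero
    have hne : ∃ k, c k ≠ 0 := by
      by_contra hall
      simp only [not_exists, not_not] at hall
      apply hx0
      rw [hxsum]
      simp [hall]
    obtain ⟨k, hk⟩ := hne
    exact Finset.sum_pos' (fun i _ => Complex.normSq_nonneg _)
      ⟨k, Finset.mem_univ _, Complex.normSq_pos.2 hk⟩
  · rw [hsign, hval, Finset.mul_sum, Complex.ofReal_sum]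
    refine Finset.sum_congr rfl fun k _ => ?_
    by_cases hk : c k = 0
    · simp [hk]
    · have hs := hodgeSign_add_mul_inv_mul_inv n m (deg k.1) (deg' k.2)
      rw [hsupp k hk] at hs
      rw [← Complex.mul_conj]
      linear_combination (c k * starRingEnd ℂ (c k)) * hs

/-! ### The product polarization and `HS^pol` under `⊗` -/

/-- **The product polarization `Q₁ ⊗ Q₂` of `H₁ ⊗ H₂`** ("the subcategory `HS^pol_ℚ` is closed
under […] tensor products", Moonen §2.1; Deligne, Hodge II, 2.1.15): the bilinear form
`(v ⊗ w, v' ⊗ w') ↦ Q₁(v, v') Q₂(w, w')` (Mathlib's `LinearMap.BilinForm.tmul`) is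
`(-1)^{n+m}`-symmetric and satisfies both Hodge–Riemann relations for the tensor Hodge structure
`H₁.tensor H₂` of weight `n + m`. [cite: Moonen2017FamiliesMotives, §2.1 (p. 3)]
[cite: DeligneHodgeII1971, 2.1.15] -/
def Polarization.tensor (Q₁ : Polarization H₁) (Q₂ : Polarization H₂) :
    Polarization (H₁.tensor H₂) where
  form := Q₁.tensorForm₂ Q₂
  flip_form := Q₁.tensorForm₂_flip Q₂
  form_apply_eq_zero p x hx y hy := Q₁.tensorForm₂_apply_eq_zero Q₂ p x hx y hy
  pos P Q' hPQ x hx hx0 := Q₁.tensorForm₂_pos Q₂ P Q' hPQ x hx hx0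

/-- The form of `Q₁.tensor Q₂` is `Q₁ ⊗ Q₂ = Polarization.tensorForm₂`.
[cite: Moonen2017FamiliesMotives, §2.1 (p. 3)] -/
@[simp]
theorem Polarization.tensor_form (Q₁ : Polarization H₁) (Q₂ : Polarization H₂) :
    (Q₁.tensor Q₂).form = Q₁.tensorForm₂ Q₂ :=
  rfl

/-- … and, unfolded, Mathlib's `LinearMap.BilinForm.tmul Q₁.form Q₂.form`.
[cite: Moonen2017FamiliesMotives, §2.1 (p. 3)] -/
theorem Polarization.tensor_form_eq_tmul (Q₁ : Polarization H₁) (Q₂ : Polarization H₂) :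
    (Q₁.tensor Q₂).form = Q₁.form.tmul Q₂.form :=
  rfl

/-- On pure tensors: `(Q₁ ⊗ Q₂)(v ⊗ w, v' ⊗ w') = Q₁(v, v') Q₂(w, w')`.
[cite: Moonen2017FamiliesMotives, §2.1 (p. 3)] [cite: DeligneHodgeII1971, 2.1.15] -/
theorem Polarization.tensor_form_tmul (Q₁ : Polarization H₁) (Q₂ : Polarization H₂) (v v' : V)
    (w w' : W) :
    (Q₁.tensor Q₂).form (v ⊗ₜ[ℚ] w) (v' ⊗ₜ[ℚ] w') = Q₁.form v v' * Q₂.form w w' :=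
  Q₁.tensorForm₂_tmul Q₂ v v' w w'

/-- **`HS^pol_ℚ` is closed under tensor products** (Moonen §2.1): if `H₁` and `H₂` are polarizable,
so is `H₁ ⊗ H₂`. [cite: Moonen2017FamiliesMotives, §2.1 (p. 3)] [cite: DeligneHodgeII1971, 2.1.15] -/
theorem IsPolarizable.tensor (h₁ : H₁.IsPolarizable) (h₂ : H₂.IsPolarizable) :
    (H₁.tensor H₂).IsPolarizable := by
  obtain ⟨Q₁⟩ := h₁
  obtain ⟨Q₂⟩ := h₂
  exact ⟨Q₁.tensor Q₂⟩

/-! ### Duals and internal Hom -/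

/-- **The dual polarization** of `H^∨` ("closed under […] duality", Moonen §2.1): the twisted
polarization of `H(n)` pulled back along the isomorphism `θ⁻¹ : H^∨ → H(n)` of Hodge structures
defined by `Q` (the tree's `Polarization.dualToTwistHom`, `Polarization.comap`) — the explicit
term behind the tree's `IsPolarizable.dual`; its form is the inverse form
`Q^∨(φ, ψ) = Q(θ⁻¹ φ, θ⁻¹ ψ)` (`Polarization.dual_form`). [cite: Moonen2017FamiliesMotives, §2.1 (p. 3)]
[cite: DeligneHodgeII1971, 2.1.15] -/
def Polarization.dual {H : HodgeStructure V n} (Q : Polarization H) : Polarization H.dual :=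
  ((Q.tateTwist n).cast (tateTwist_self_weight n)).comap Q.dualToTwistHom
    Q.toDualEquiv.symm.injective

/-- The form of `Q.dual` is the inverse form `Q^∨ = Polarization.dualForm`.
[cite: Moonen2017FamiliesMotives, §2.1 (p. 3)] -/
@[simp]
theorem Polarization.dual_form {H : HodgeStructure V n} (Q : Polarization H) :
    Q.dual.form = Q.dualForm :=
  rfl

/-- **The internal-Hom polarization** of `Hom(H₁, H₂)`: the product polarization `Q₁^∨ ⊗ Q₂` of
`H₁^∨ ⊗ H₂` (weight `-n + m` transported to `m - n`) pulled back along the isomorphism of Hodge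
structures `Hom(H₁, H₂) → H₁^∨ ⊗ H₂` (the tree's `Hom.homToDualTensor`, inverse of
`φ ⊗ w ↦ (x ↦ φ(x) w)`; El Zein–Lê §3.1.1.3), by the tree's `Polarization.comap`.
[cite: Moonen2017FamiliesMotives, §2.1 (p. 3)] [cite: CattaniElZeinGriffithsLe2014, Ch. 3 §3.1.1.3 (1)–(2) pp. 131–132] -/
def Polarization.hom (Q₁ : Polarization H₁) (Q₂ : Polarization H₂) : Polarization (H₁.hom H₂) :=
  ((Q₁.dual.tensor Q₂).cast (neg_add_eq_sub n m)).comap (Hom.homToDualTensor H₁ H₂) (by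
    rw [Hom.homToDualTensor_toLinearMap]
    exact (dualTensorHomEquiv ℚ V W).symm.injective)

/-- **`HS^pol_ℚ` is closed under internal Hom**: if `H₁` and `H₂` are polarizable, so is
`Hom(H₁, H₂) ≅ H₁^∨ ⊗ H₂` (Moonen §2.1: closed under tensor products and duality).
[cite: Moonen2017FamiliesMotives, §2.1 (p. 3)] [cite: DeligneHodgeII1971, 2.1.15] -/
theorem IsPolarizable.hom (h₁ : H₁.IsPolarizable) (h₂ : H₂.IsPolarizable) :
    (H₁.hom H₂).IsPolarizable := by
  obtain ⟨Q₁⟩ := h₁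
  obtain ⟨Q₂⟩ := h₂
  exact ⟨Q₁.hom Q₂⟩

end HodgeStructure

end Literature.AlgebraicGeometry.Motives

end
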